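import Summits.AnomalousDissipation.AnomalousDissipation.Theorems.SawtoothPulseCascadeK1LocalisedCascadeLedgerRecursion

/-!
# K1loc, line `Spectral` / thin start — helper: THE END-SHAPE OF THE FIBRE LEDGER (abstract chain of the six step inequalities)

Helper file of the prover lane on the crux `K1LocalisedCascade` (stmt-AnomalousDissipation-19491), route
`SawtoothPulseCascade` (S-D fibre ledger; memo v12 §13).  The six ledger steps (`…StripStepV` (S-V), `…LowFibreStepH` (T-H),
`…RatioClassStepV` (A-V), `…RatioClassStepH` (B-H, Bc-H)) are, along a threshold schedule, real-sequence inequalities of the shapes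
  `S_{j+1} ≤ T_j + (w^S_j + √Bc_j)² + f_j`,  `T_j ≤ S_j + (w^T_j + √A_j(0))² + f_j`,  `Bc_j ≤ (w^{Bc}_j + √A_j(0))² + f_j`,
  `A_{j+1}(m) ≤ (w^A_j + √B_j(m+1))² + f_j`,  `B_j(m) ≤ (w^B_j + √A_j(m))² + f_j`
(`m` = number of threshold doublings above the schedule; `f_j` = far tails).  This file fixes that END-SHAPE and proves, purely in `ℝ`:
* `sqrt_le_escalate_nat` — index form of threshold escalation: `√a_{j+n}(m) ≤ √a_j(m+n) + Σ_{i<n} w_{j+i}`;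
* `shell_escalation` — from (A-V)+(B-H): `√A_{j+1}(m) ≤ √A_j(m+1) + (w^A_j + w^B_j + 2√f_j)`, hence with a cap `A_j(m) ≤ F_j(m)`
  (far tail): `√A_{j+n}(m) ≤ √F_j(m+n) + Σ_{i<n}(w^A + w^B + 2√f)_{j+i}`;
* `strip_chain` — from (S-V)+(T-H): `S_{j+1} ≤ S_j + e_j`, `e_j = (w^T_j + √A_j(0))² + (w^S_j + √Bc_j)² + 2f_j`, hence
  `S_{j₀+n} ≤ S_{j₀} + Σ_{i<n} e_{j₀+i}` — uniform in `n` as soon as `Σ e < ∞`.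
The assembly instantiates `S, T, A, B, Bc, w, f, F` with the class energies of the iterates and the explicit junk amplitudes.
Pure real analysis; no definitions; no statement about the crux. [cite: Grafakos2014, Prop. 3.2.7 (3)] [problem: turb]
-/

-- `Summit.<Summit>.<Problem>`: single-conjunct summit, the duplicate namespace segment is deliberate.
set_option linter.dupNamespace false

noncomputable section

namespace Summit.AnomalousDissipation.AnomalousDissipation.Theorems.SawtoothPulseCascade.K1Window

open Finset

/-! ## §1 Elementary square-root bookkeeping -/

/-- `x ≤ (u + √y)² + f` with `u, y, f ≥ 0` gives `√x ≤ u + √y + √f`. [folklore] -/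
theorem sqrt_le_of_le_sq_add {x u y f : ℝ} (h : x ≤ (u + Real.sqrt y) ^ 2 + f) (hu : 0 ≤ u) (hf : 0 ≤ f) :
    Real.sqrt x ≤ u + Real.sqrt y + Real.sqrt f := by
  have h0 : 0 ≤ u + Real.sqrt y := add_nonneg hu (Real.sqrt_nonneg _)
  have hs : 0 ≤ u + Real.sqrt y + Real.sqrt f := add_nonneg h0 (Real.sqrt_nonneg _)
  -- `(u + √y)² + f ≤ (u + √y + √f)²`
  have h1 : (u + Real.sqrt y) ^ 2 + f ≤ (u + Real.sqrt y + Real.sqrt f) ^ 2 := by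
    have e : Real.sqrt f ^ 2 = f := Real.sq_sqrt hf
    nlinarith [mul_nonneg h0 (Real.sqrt_nonneg f)]
  calc Real.sqrt x ≤ Real.sqrt ((u + Real.sqrt y + Real.sqrt f) ^ 2) := Real.sqrt_le_sqrt (h.trans h1)
    _ = u + Real.sqrt y + Real.sqrt f := Real.sqrt_sq hs

/-! ## §2 Threshold escalation, index form -/

/-- **Escalation, index form**: `√a_{j+1}(m) ≤ √a_j(m+1) + w_j` for `j ≥ j₀` gives
`√a_{j+n}(m) ≤ √a_j(m+n) + Σ_{i<n} w_{j+i}`. [folklore] -/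
theorem sqrt_le_escalate_nat {a : ℕ → ℕ → ℝ} {w : ℕ → ℝ} {j₀ : ℕ}
    (h : ∀ j, j₀ ≤ j → ∀ m : ℕ, Real.sqrt (a (j + 1) m) ≤ Real.sqrt (a j (m + 1)) + w j) :
    ∀ (n j : ℕ), j₀ ≤ j → ∀ m : ℕ, Real.sqrt (a (j + n) m) ≤ Real.sqrt (a j (m + n)) + ∑ i ∈ range n, w (j + i) := by
  intro n
  induction n with
  | zero => intro j _ m; simp
  | succ n ih =>
    intro j hj m
    have h1 := h (j + n) (hj.trans (Nat.le_add_right _ _)) m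
    have h2 := ih j hj (m + 1)
    rw [sum_range_succ, ← add_assoc, show m + (n + 1) = m + 1 + n by ring]
    linarith

/-- **Shell escalation** from the (A-V) and (B-H) shapes: with `w̃_j = w^A_j + w^B_j + 2√f_j`,
`√A_{j+1}(m) ≤ √A_j(m+1) + w̃_j`. [folklore] -/
theorem shell_step {A B : ℕ → ℕ → ℝ} {wA wB f : ℕ → ℝ} {j₀ : ℕ} (hwA : ∀ j, 0 ≤ wA j) (hwB : ∀ j, 0 ≤ wB j)
    (hf : ∀ j, 0 ≤ f j)
    (hA : ∀ j, j₀ ≤ j → ∀ m, A (j + 1) m ≤ (wA j + Real.sqrt (B j (m + 1))) ^ 2 + f j)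
    (hB : ∀ j, j₀ ≤ j → ∀ m, B j m ≤ (wB j + Real.sqrt (A j m)) ^ 2 + f j) :
    ∀ j, j₀ ≤ j → ∀ m, Real.sqrt (A (j + 1) m) ≤ Real.sqrt (A j (m + 1)) + (wA j + wB j + 2 * Real.sqrt (f j)) := by
  intro j hj m
  have h1 := sqrt_le_of_le_sq_add (hA j hj m) (hwA j) (hf j)
  have h2 := sqrt_le_of_le_sq_add (hB j hj (m + 1)) (hwB j) (hf j)
  linarith

/-- **Shell escalation into the far tail**: with a cap `A_j(m) ≤ F_j(m)` and `w̃` as above,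
`√A_{j+n}(m) ≤ √F_j(m+n) + Σ_{i<n} w̃_{j+i}`. [folklore] -/
theorem shell_escalation {A B F : ℕ → ℕ → ℝ} {wA wB f : ℕ → ℝ} {j₀ : ℕ} (hwA : ∀ j, 0 ≤ wA j) (hwB : ∀ j, 0 ≤ wB j)
    (hf : ∀ j, 0 ≤ f j)
    (hA : ∀ j, j₀ ≤ j → ∀ m, A (j + 1) m ≤ (wA j + Real.sqrt (B j (m + 1))) ^ 2 + f j)
    (hB : ∀ j, j₀ ≤ j → ∀ m, B j m ≤ (wB j + Real.sqrt (A j m)) ^ 2 + f j)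
    (hF : ∀ j, j₀ ≤ j → ∀ m, A j m ≤ F j m) (n j : ℕ) (hj : j₀ ≤ j) (m : ℕ) :
    Real.sqrt (A (j + n) m) ≤ Real.sqrt (F j (m + n)) + ∑ i ∈ range n, (wA (j + i) + wB (j + i) + 2 * Real.sqrt (f (j + i))) := by
  have h := sqrt_le_escalate_nat (a := A) (w := fun j => wA j + wB j + 2 * Real.sqrt (f j)) (shell_step hwA hwB hf hA hB) n j hj m
  exact h.trans (by linarith [Real.sqrt_le_sqrt (hF j hj (m + n))])

/-! ## §3 The strip chain -/

/-- **Strip chain** from the (S-V) and (T-H) shapes: `S_{j+1} ≤ S_j + e_j` with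
`e_j = (w^T_j + √A_j(0))² + (w^S_j + √Bc_j)² + 2f_j`. [folklore] -/
theorem strip_step {S T Bc : ℕ → ℝ} {A : ℕ → ℕ → ℝ} {wS wT f : ℕ → ℝ} {j₀ : ℕ}
    (hS : ∀ j, j₀ ≤ j → S (j + 1) ≤ T j + (wS j + Real.sqrt (Bc j)) ^ 2 + f j)
    (hT : ∀ j, j₀ ≤ j → T j ≤ S j + (wT j + Real.sqrt (A j 0)) ^ 2 + f j) :
    ∀ j, j₀ ≤ j → S (j + 1) ≤ S j + ((wT j + Real.sqrt (A j 0)) ^ 2 + (wS j + Real.sqrt (Bc j)) ^ 2 + 2 * f j) := by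
  intro j hj
  have h1 := hS j hj
  have h2 := hT j hj
  linarith

/-- **The strip is bounded uniformly in the number of phases**:
`S_{j₀+n} ≤ S_{j₀} + Σ_{i<n} [(w^T + √A(0))² + (w^S + √Bc)² + 2f]_{j₀+i}`. [folklore] -/
theorem strip_chain {S T Bc : ℕ → ℝ} {A : ℕ → ℕ → ℝ} {wS wT f : ℕ → ℝ} {j₀ : ℕ}
    (hS : ∀ j, j₀ ≤ j → S (j + 1) ≤ T j + (wS j + Real.sqrt (Bc j)) ^ 2 + f j)
    (hT : ∀ j, j₀ ≤ j → T j ≤ S j + (wT j + Real.sqrt (A j 0)) ^ 2 + f j) (n : ℕ) :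
    S (j₀ + n) ≤ S j₀ + ∑ i ∈ range n,
      ((wT (j₀ + i) + Real.sqrt (A (j₀ + i) 0)) ^ 2 + (wS (j₀ + i) + Real.sqrt (Bc (j₀ + i))) ^ 2 + 2 * f (j₀ + i)) :=
  le_add_sum_of_step (strip_step hS hT) n

/-- **The sub-cone class in the strip chain**: `Bc_j ≤ (w^{Bc}_j + √A_j(0))² + f_j` gives `√Bc_j ≤ w^{Bc}_j + √A_j(0) + √f_j`, so
every term of `strip_chain` is controlled by the junk amplitudes and by `√A_j(0)`, which `shell_escalation` bounds by the far
tail plus the LAST `n` junk amplitudes. [folklore] -/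
theorem subcone_amplitude {Bc : ℕ → ℝ} {A : ℕ → ℕ → ℝ} {wBc f : ℕ → ℝ} {j₀ : ℕ} (hw : ∀ j, 0 ≤ wBc j) (hf : ∀ j, 0 ≤ f j)
    (hBc : ∀ j, j₀ ≤ j → Bc j ≤ (wBc j + Real.sqrt (A j 0)) ^ 2 + f j) :
    ∀ j, j₀ ≤ j → Real.sqrt (Bc j) ≤ wBc j + Real.sqrt (A j 0) + Real.sqrt (f j) :=
  fun j hj => sqrt_le_of_le_sq_add (hBc j hj) (hw j) (hf j)

/-! ## §4 Multiplicative-plus-additive chains (class-relative junk) -/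

/-- **Multiplicative-plus-additive chain**: `X_{j+1} ≤ (1+η_j)X_j + e_j` with `η_j, e_j, X_j ≥ 0` for `j ≥ j₀` gives
`X_{j₀+n} ≤ exp(Σ_{i<n} η_{j₀+i}) · (X_{j₀} + Σ_{i<n} e_{j₀+i})` — the end-shape for per-phase inequalities whose junk is RELATIVE
to the tracked class energy (sieve / fibre-`L²` forms of the half-step) plus an absolute remainder. [folklore] -/
theorem le_exp_mul_of_mult_step {X η e : ℕ → ℝ} {j₀ : ℕ} (hη : ∀ j, 0 ≤ η j) (he : ∀ j, 0 ≤ e j) (hX : ∀ j, 0 ≤ X j)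
    (h : ∀ j, j₀ ≤ j → X (j + 1) ≤ (1 + η j) * X j + e j) (n : ℕ) :
    X (j₀ + n) ≤ Real.exp (∑ i ∈ range n, η (j₀ + i)) * (X j₀ + ∑ i ∈ range n, e (j₀ + i)) := by
  induction n with
  | zero => simp
  | succ n ih =>
    have hstep := h (j₀ + n) (Nat.le_add_right _ _)
    rw [← add_assoc]
    have hE0 : 0 ≤ Real.exp (∑ i ∈ range n, η (j₀ + i)) := (Real.exp_pos _).le
    have hE1 : 1 ≤ Real.exp (∑ i ∈ range n, η (j₀ + i)) :=
      Real.one_le_exp (sum_nonneg fun i _ => hη _)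
    have hS0 : 0 ≤ X j₀ + ∑ i ∈ range n, e (j₀ + i) := add_nonneg (hX _) (sum_nonneg fun i _ => he _)
    have h1 : 1 + η (j₀ + n) ≤ Real.exp (η (j₀ + n)) := by
      have := Real.add_one_le_exp (η (j₀ + n)); linarith
    rw [sum_range_succ, sum_range_succ, Real.exp_add]
    -- `X_{j₀+n+1} ≤ (1+η)·E·S + e ≤ exp(η)·E·S + E·exp(η)·e = E·exp(η)·(S + e)`
    have h2 : (1 + η (j₀ + n)) * X (j₀ + n) ≤ Real.exp (η (j₀ + n)) * (Real.exp (∑ i ∈ range n, η (j₀ + i)) *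
        (X j₀ + ∑ i ∈ range n, e (j₀ + i))) :=
      (mul_le_mul_of_nonneg_left ih (by linarith [hη (j₀ + n)])).trans
        (mul_le_mul_of_nonneg_right h1 (mul_nonneg hE0 hS0))
    have h3 : e (j₀ + n) ≤ Real.exp (∑ i ∈ range n, η (j₀ + i)) * Real.exp (η (j₀ + n)) * e (j₀ + n) := by
      have : 1 ≤ Real.exp (∑ i ∈ range n, η (j₀ + i)) * Real.exp (η (j₀ + n)) :=
        one_le_mul_of_one_le_of_one_le hE1 (by linarith [h1, hη (j₀ + n)])
      nlinarith [he (j₀ + n)]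
    calc X (j₀ + n + 1) ≤ (1 + η (j₀ + n)) * X (j₀ + n) + e (j₀ + n) := hstep
      _ ≤ Real.exp (η (j₀ + n)) * (Real.exp (∑ i ∈ range n, η (j₀ + i)) * (X j₀ + ∑ i ∈ range n, e (j₀ + i))) +
          Real.exp (∑ i ∈ range n, η (j₀ + i)) * Real.exp (η (j₀ + n)) * e (j₀ + n) := add_le_add h2 h3
      _ = Real.exp (∑ i ∈ range n, η (j₀ + i)) * Real.exp (η (j₀ + n)) *
          (X j₀ + (∑ i ∈ range n, e (j₀ + i) + e (j₀ + n))) := by ring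

/-- **Square-root form**: `√X_{j+1} ≤ (1+η_j)√X_j + w_j` (`η_j, w_j ≥ 0`) gives
`√X_{j₀+n} ≤ exp(Σ_{i<n} η_{j₀+i}) · (√X_{j₀} + Σ_{i<n} w_{j₀+i})`. [folklore] -/
theorem sqrt_le_exp_mul_of_mult_step {X η w : ℕ → ℝ} {j₀ : ℕ} (hη : ∀ j, 0 ≤ η j) (hw : ∀ j, 0 ≤ w j)
    (h : ∀ j, j₀ ≤ j → Real.sqrt (X (j + 1)) ≤ (1 + η j) * Real.sqrt (X j) + w j) (n : ℕ) :
    Real.sqrt (X (j₀ + n)) ≤ Real.exp (∑ i ∈ range n, η (j₀ + i)) * (Real.sqrt (X j₀) + ∑ i ∈ range n, w (j₀ + i)) :=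
  le_exp_mul_of_mult_step (X := fun j => Real.sqrt (X j)) hη hw (fun _ => Real.sqrt_nonneg _) h n

end Summit.AnomalousDissipation.AnomalousDissipation.Theorems.SawtoothPulseCascade.K1Window
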